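import Summits.ResolutionOfSingularities.ResolutionOfSingularities.Theorems.EquisingularLiftEquisingularLiftNatFirstOrderLinSubst
import Summits.ResolutionOfSingularities.ResolutionOfSingularities.Theorems.EquisingularLiftEquisingularLiftOrdinaryPointsAnyChart
import HarnessLib

/-!
# [OURS · tools] THE FIRST-ORDER DATUM OF A MARKED POINT TRAVELS TO THE VERTEX CHART OF THE NORMALISED FORM (two-term chart expansion, free chart index)
# (cruxes `EquisingularLift` stmt-…-15660; `EquisingularLiftNat(Three)` stmt-…-20038 / -20148)

[OURS · leafhand-res-equisingularlift-9 g0, 2026-08-31; cell `pub/decomp-res`] AI-produced, weaker than expert review; NOT a statement of any manuscript;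
nothing here proves resolution of singularities.  DEF-FREE helper; no `sorry`; standard axioms; ZERO named hypotheses; EVERY FIELD.

leafhand-7 g1's ✓ `MultiOrd.ord_linSubst_of_translatedChart₂` (…OrdinaryPointsAnyChart) transports the TANGENT CONE of a marked point `P = [B_{·c}]` from the
translated chart of `F(x_{c₀} := 1)` at `P` to the vertex chart `(σ_{τ'}F)(x_c := 1)` of the normalised form.  A FIRST-ORDER point (this hand,
✓ `FirstOrderPoint.exists_strictTransform`) is read off the TWO leading forms `(Φ_μ, Ψ_{μ+1})` of the chart, so the transport must keep one more term:

* `FirstOrderPoint.add_pow_succ_eq` / `add_pow_eq` — `(a + b)^k = a^k + k·a^{k−1}·b + b²·t`;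
* ★ `FirstOrderPoint.dehomogenize_aeval_eq_initial_two_add₂` — TWO-TERM EXPANSION of the chart at `e_c` of `σ*P` along the chart of `P` at `e_{c₀}`:
  with `ρ_{c₀} = λ + L` (`L` without constant term), `M` the other `ρ_i`, and `P(x_{c₀} := 1) = Φ + Ψ₁ + Ψ'`:
  `(σ*P)(x_c := 1) = λ^{e−μ}Φ(M) + [(e−μ)λ^{e−μ−1}·L·Φ(M) + λ^{e−μ−1}Ψ₁(M)] + (y)^{μ+2}`;
* ★ `FirstOrderPoint.firstOrder_linSubst_of_translatedChart₂` — THE FIRST-ORDER DATUM TRAVELS (free chart index, every field): if the chart of `F` at `c₀`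
  translated to `b` reads `Φ + Ψ₁ + Ψ'` with (FO), then `(σ_{τ'}F)(x_c := 1) = Φ' + Ψ₁' + Ψ''` with `Φ' ≠ 0` of degree `μ`, `Ψ₁'` of degree `μ + 1`,
  `Ψ'' ∈ (y)^{μ+2}` and (FO) (✓ `FirstOrderPoint.firstOrder_of_linSubst`: the new pair is `(u·Φ(M), A·Φ(M) + w·Ψ₁(M))`, `u, w ≠ 0`).

Used by the matrix-form theorems of the next file (`…NatFirstOrderPointsMatrix`).

References: [Hartshorne1977, I Ex. 5.8, II Example 7.1.1]; [Matsumura1987, §14]; [Humphreys1990, §3.10].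
-/

set_option linter.dupNamespace false -- mandated namespace `Summit.<Summit>.<Problem>` of this single-conjunct summit

noncomputable section

open CategoryTheory CategoryTheory.Limits AlgebraicGeometry TopologicalSpace
open MvPolynomial
open Literature.AlgebraicGeometry.Resolution
open Literature.AlgebraicGeometry.Motives Literature.AlgebraicGeometry.Motives.SmoothHypersurface
open Literature.AlgebraicGeometry.Motives.ProjectiveSpace
open Summit.ResolutionOfSingularities.ResolutionOfSingularities.Cruxes.EquisingularLift.StrataSplit

namespace Summit.ResolutionOfSingularities.ResolutionOfSingularities.Cruxes.EquisingularLiftNat.Sections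

namespace FirstOrderPoint

open MultiOrd

variable {K : Type} [Field K] {N : ℕ}

/-! ## First-order binomial expansion -/

/-- `(a + b)^{j+1} = a^{j+1} + (j+1)·a^j·b + b²·t` in a commutative ring. [folklore] -/
theorem add_pow_succ_eq {R : Type} [CommRing R] (a b : R) (j : ℕ) :
    ∃ t : R, (a + b) ^ (j + 1) = a ^ (j + 1) + ((j + 1 : ℕ) : R) * a ^ j * b + b ^ 2 * t := by
  induction j with
  | zero => exact ⟨0, by push_cast; ring⟩
  | succ j ih =>
    obtain ⟨t, ht⟩ := ih
    refine ⟨a * t + ((j + 1 : ℕ) : R) * a ^ j + b * t, ?_⟩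
    rw [pow_succ, ht]
    push_cast
    ring

/-- `(a + b)^k = a^k + k·a^{k−1}·b + b²·t` in a commutative ring (for `k = 0` the middle term is `0`). [folklore] -/
theorem add_pow_eq {R : Type} [CommRing R] (a b : R) (k : ℕ) :
    ∃ t : R, (a + b) ^ k = a ^ k + (k : R) * a ^ (k - 1) * b + b ^ 2 * t := by
  cases k with
  | zero => exact ⟨0, by simp⟩
  | succ j =>
    obtain ⟨t, ht⟩ := add_pow_succ_eq a b j
    exact ⟨t, by rw [ht, Nat.add_sub_cancel]⟩

/-! ## ★ Two-term chart expansion -/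

/-- ★ **Initial form, next form and remainder — two indices.**  `P` a form of degree `e` with `P(x_{c₀} := 1) = Φ + (Ψ₁ + Ψ')` (`Φ` a form of degree
`μ ≤ e`, `Ψ₁` a form of degree `μ + 1`, `Ψ' ∈ (y)^{μ+2}`); `σ` a substitution whose charts `ρ_i = σ_i(x_c := 1)` have no constant term for `i ≠ c₀`;
`λ = ρ_{c₀}(0)`, `L = ρ_{c₀} − λ`, `M_j = ρ_{c₀.succAbove j}`.  Then
`(σ*P)(x_c := 1) = λ^{e−μ}·Φ(M) + ((e−μ)λ^{e−μ−1}·L·Φ(M) + λ^{e−μ−1}·Ψ₁(M)) + Ψ''`, `Ψ'' ∈ (y)^{μ+2}`. [cite: Matsumura1987, §14] -/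
theorem dehomogenize_aeval_eq_initial_two_add₂ (c c₀ : Fin (N + 1)) {e : ℕ} {P : MvPolynomial (Fin (N + 1)) K} (hP : P.IsHomogeneous e)
    {Φ Ψ₁ Ψ' : MvPolynomial (Fin N) K} {μ : ℕ} (hΦ : Φ.IsHomogeneous μ) (hΨ₁ : Ψ₁.IsHomogeneous (μ + 1))
    (hΨ' : Ψ' ∈ Ideal.span (Set.range (X : Fin N → MvPolynomial (Fin N) K)) ^ (μ + 2)) (hμe : μ ≤ e)
    (hdeh : ProjectiveSpace.dehomogenize K c₀ P = Φ + (Ψ₁ + Ψ'))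
    (σ : Fin (N + 1) → MvPolynomial (Fin (N + 1)) K)
    (hσ : ∀ i, i ≠ c₀ → constantCoeff (ProjectiveSpace.dehomogenize K c (σ i)) = 0) :
    ∃ Ψ'' : MvPolynomial (Fin N) K, Ψ'' ∈ Ideal.span (Set.range (X : Fin N → MvPolynomial (Fin N) K)) ^ (μ + 2) ∧
      ProjectiveSpace.dehomogenize K c (aeval σ P) =
        C (constantCoeff (ProjectiveSpace.dehomogenize K c (σ c₀)) ^ (e - μ)) *
            aeval (fun j => ProjectiveSpace.dehomogenize K c (σ (c₀.succAbove j))) Φ +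
          ((C (((e - μ : ℕ) : K) * constantCoeff (ProjectiveSpace.dehomogenize K c (σ c₀)) ^ (e - μ - 1)) *
                (ProjectiveSpace.dehomogenize K c (σ c₀) - C (constantCoeff (ProjectiveSpace.dehomogenize K c (σ c₀)))) *
                aeval (fun j => ProjectiveSpace.dehomogenize K c (σ (c₀.succAbove j))) Φ +
              C (constantCoeff (ProjectiveSpace.dehomogenize K c (σ c₀)) ^ (e - μ - 1)) *
                aeval (fun j => ProjectiveSpace.dehomogenize K c (σ (c₀.succAbove j))) Ψ₁) + Ψ'') := by
  classical
  set I : Ideal (MvPolynomial (Fin N) K) := Ideal.span (Set.range (X : Fin N → MvPolynomial (Fin N) K)) with hI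
  set ρc := ProjectiveSpace.dehomogenize K c (σ c₀) with hρc
  set M : Fin N → MvPolynomial (Fin N) K := fun j => ProjectiveSpace.dehomogenize K c (σ (c₀.succAbove j)) with hM
  set lam := constantCoeff ρc with hlam
  set L := ρc - C lam with hL
  have hρ : ρc = C lam + L := by rw [hL]; ring
  have hMmem : ∀ j, M j ∈ I := fun j => mem_span_X_of_constantCoeff_eq_zero (hσ _ (Fin.succAbove_ne c₀ j))
  have hLmem : L ∈ I := by
    refine mem_span_X_of_constantCoeff_eq_zero ?_
    rw [hL, map_sub, constantCoeff_C, hlam, sub_self]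
  -- the components of `Q = P(x_{c₀} := 1)`
  have hΨmem : Ψ₁ + Ψ' ∈ I ^ (μ + 1) := add_mem_pow_succ K hΨ₁ hΨ'
  obtain ⟨hQμ, hQlt⟩ := homogeneousComponent_add_of_mem_pow hΦ hΨmem
  have hQμ1 : homogeneousComponent (μ + 1) (ProjectiveSpace.dehomogenize K c₀ P) = Ψ₁ := by
    rw [hdeh, map_add, homogeneousComponent_of_mem hΦ, if_neg (Nat.succ_ne_self μ), zero_add]
    exact (homogeneousComponent_add_of_mem_pow hΨ₁ hΨ').1
  have hQgt : homogeneousComponent (e + 1) (ProjectiveSpace.dehomogenize K c₀ P) = 0 :=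
    homogeneousComponent_eq_zero (e + 1) _ (Nat.lt_succ_of_le (totalDegree_dehomogenize_le c₀ hP))
  -- the expansion, over `range (e + 2)` (the extra term vanishes)
  set T : ℕ → MvPolynomial (Fin N) K := fun m => ρc ^ (e - m) *
    aeval M (homogeneousComponent m (ProjectiveSpace.dehomogenize K c₀ P)) with hT
  have hexp : ProjectiveSpace.dehomogenize K c (aeval σ P) = ∑ m ∈ Finset.range (e + 2), T m := by
    rw [Finset.sum_range_succ, dehomogenize_aeval_eq_sum₂ c c₀ hP σ]
    simp only [hT, hQgt, map_zero, mul_zero, add_zero, hρc, hM]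
  have hμmem : μ ∈ Finset.range (e + 2) := Finset.mem_range.mpr (by omega)
  have hμ1mem : μ + 1 ∈ (Finset.range (e + 2)).erase μ :=
    Finset.mem_erase.mpr ⟨Nat.succ_ne_self μ, Finset.mem_range.mpr (by omega)⟩
  rw [← Finset.add_sum_erase _ _ hμmem, ← Finset.add_sum_erase _ _ hμ1mem] at hexp
  -- the two leading terms
  obtain ⟨t, ht⟩ := add_pow_eq (C lam) L (e - μ)
  obtain ⟨t', ht'⟩ := sub_dvd_pow_sub_pow ρc (C lam) (e - μ - 1)
  have hTμ : T μ = (C lam ^ (e - μ) + ((e - μ : ℕ) : MvPolynomial (Fin N) K) * C lam ^ (e - μ - 1) * L + L ^ 2 * t) * aeval M Φ := by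
    simp only [hT, hdeh, hQμ]
    rw [hρ, ht]
  have hTμ1 : T (μ + 1) = (C lam ^ (e - μ - 1) + (ρc - C lam) * t') * aeval M Ψ₁ := by
    simp only [hT, hQμ1]
    rw [show e - (μ + 1) = e - μ - 1 by omega, ← ht']
    ring
  -- the rest lies in `I^{μ+2}`
  have hrest : ∀ m ∈ ((Finset.range (e + 2)).erase μ).erase (μ + 1), T m ∈ I ^ (μ + 2) := by
    intro m hm
    have hne1 : m ≠ μ + 1 := Finset.ne_of_mem_erase hm
    have hne : m ≠ μ := Finset.ne_of_mem_erase (Finset.mem_of_mem_erase hm)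
    rcases Nat.lt_or_gt_of_ne hne with hlt | hgt
    · have h0 : homogeneousComponent m (ProjectiveSpace.dehomogenize K c₀ P) = 0 := by rw [hdeh]; exact hQlt m hlt
      simp only [hT, h0, map_zero, mul_zero]
      exact zero_mem _
    · have hge : μ + 2 ≤ m := by omega
      have hmem : aeval M (homogeneousComponent m (ProjectiveSpace.dehomogenize K c₀ P)) ∈ I ^ (μ + 2) :=
        Ideal.pow_le_pow_right hge (aeval_mem_pow_of_forall_mem M hMmem (mem_pow_of_isHomogeneous (homogeneousComponent_isHomogeneous m _)))
      exact (I ^ (μ + 2)).mul_mem_left _ hmem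
  have hΦM : aeval M Φ ∈ I ^ μ := aeval_mem_pow_of_forall_mem M hMmem (mem_pow_of_isHomogeneous hΦ)
  have hΨ₁M : aeval M Ψ₁ ∈ I ^ (μ + 1) := aeval_mem_pow_of_forall_mem M hMmem (mem_pow_of_isHomogeneous hΨ₁)
  refine ⟨L ^ 2 * t * aeval M Φ + (ρc - C lam) * t' * aeval M Ψ₁ + ∑ m ∈ ((Finset.range (e + 2)).erase μ).erase (μ + 1), T m, ?_, ?_⟩
  · refine (I ^ (μ + 2)).add_mem ((I ^ (μ + 2)).add_mem ?_ ?_) (Ideal.sum_mem _ hrest)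
    · have h := Ideal.mul_mem_mul ((I ^ 2).mul_mem_right t (Ideal.pow_mem_pow hLmem 2)) hΦM
      rw [← pow_add, show 2 + μ = μ + 2 by omega] at h
      exact h
    · have h := Ideal.mul_mem_mul (I.mul_mem_right t' (hL ▸ hLmem : ρc - C lam ∈ I)) hΨ₁M
      rw [← pow_succ', show μ + 1 + 1 = μ + 2 by omega] at h
      exact h
  · rw [hexp, hTμ, hTμ1, ← hL]
    simp only [map_pow, map_mul, map_natCast]
    ring

/-! ## ★ The first-order datum travels, free chart index -/

/-- ★ **Transport of the first-order datum, free chart — every field.**  `τ, τ'` mutually inverse linear substitutions; `b` with `b_{c₀} = 1` and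
`τ'(e_c) = λ·b`; `F` a form of degree `d` whose chart `F(x_{c₀} := 1)` translated to `b` is `Φ + (Ψ₁ + Ψ')` (`Φ ≠ 0` of degree `μ`, `Ψ₁` of degree `μ + 1`,
`Ψ' ∈ (y)^{μ+2}`) with the first-order criterion (FO).  Then `σ_{τ'}F(x_c := 1) = Φ' + (Ψ₁' + Ψ'')` with `Φ' ≠ 0` of degree `μ`, `Ψ₁'` of degree `μ + 1`,
`Ψ'' ∈ (y)^{μ+2}` and (FO) — the argument of ✓ `MultiOrd.ord_linSubst_of_translatedChart₂` with the two-term expansion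
`dehomogenize_aeval_eq_initial_two_add₂` and ✓ `firstOrder_of_linSubst` (`Φ' = λ^{d−μ}Φ(M)`, `Ψ₁' = (d−μ)λ^{d−μ−1}L·Φ(M) + λ^{d−μ−1}Ψ₁(M)`).
[cite: Hartshorne1977, I Ex. 5.8, II Example 7.1.1] [cite: Matsumura1987, §14] -/
theorem firstOrder_linSubst_of_translatedChart₂ {m : ℕ} (c c₀ : Fin (m + 2 + 1))
    (τ τ' : Fin (m + 2 + 1) → MvPolynomial (Fin (m + 2 + 1)) K) (hτ : ∀ i, (τ i).IsHomogeneous 1) (hτ' : ∀ i, (τ' i).IsHomogeneous 1)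
    (hinv : ∀ i, aeval τ (τ' i) = X i) (hinv' : ∀ i, aeval τ' (τ i) = X i)
    (b : Fin (m + 2 + 1) → K) (hb1 : b c₀ = 1)
    (hbτ : ∀ i, eval (Pi.single c 1 : Fin (m + 2 + 1) → K) (τ' i) = eval (Pi.single c 1 : Fin (m + 2 + 1) → K) (τ' c₀) * b i)
    (F : MvPolynomial (Fin (m + 2 + 1)) K) {d : ℕ} (hF : F.IsHomogeneous d)
    {μ : ℕ} {Φ Ψ₁ Ψ' : MvPolynomial (Fin (m + 2)) K} (hΦ : Φ.IsHomogeneous μ) (hΦ0 : Φ ≠ 0) (hΨ₁ : Ψ₁.IsHomogeneous (μ + 1))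
    (hΨ' : Ψ' ∈ Ideal.span (Set.range (X : Fin (m + 2) → MvPolynomial (Fin (m + 2)) K)) ^ (μ + 2))
    (hfo : ∀ P : Ideal (MvPolynomial (Fin (m + 2)) K), P.IsPrime → Φ ∈ P → (∀ i, pderiv i Φ ∈ P) → Ψ₁ ∈ P →
      ∀ i, (X i : MvPolynomial (Fin (m + 2)) K) ∈ P)
    (heq : aeval (fun j : Fin (m + 2) => (X j : MvPolynomial (Fin (m + 2)) K) + C (b (c₀.succAbove j))) (ProjectiveSpace.dehomogenize K c₀ F) =
      Φ + (Ψ₁ + Ψ')) :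
    ∃ (Φ' Ψ₁' Ψ'' : MvPolynomial (Fin (m + 2)) K), Φ'.IsHomogeneous μ ∧ Φ' ≠ 0 ∧ Ψ₁'.IsHomogeneous (μ + 1) ∧
      Ψ'' ∈ Ideal.span (Set.range (X : Fin (m + 2) → MvPolynomial (Fin (m + 2)) K)) ^ (μ + 2) ∧
      ProjectiveSpace.dehomogenize K c (aeval τ' F) = Φ' + (Ψ₁' + Ψ'') ∧
      ∀ P : Ideal (MvPolynomial (Fin (m + 2)) K), P.IsPrime → Φ' ∈ P → (∀ i, pderiv i Φ' ∈ P) → Ψ₁' ∈ P →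
        ∀ i, (X i : MvPolynomial (Fin (m + 2)) K) ∈ P := by
  classical
  set sh : Fin (m + 2 + 1) → MvPolynomial (Fin (m + 2 + 1)) K :=
    fun i => if i = c₀ then (X c₀ : MvPolynomial (Fin (m + 2 + 1)) K) else X i + C (1 * b i) * X c₀ with hsh
  set ush : Fin (m + 2 + 1) → MvPolynomial (Fin (m + 2 + 1)) K :=
    fun i => if i = c₀ then (X c₀ : MvPolynomial (Fin (m + 2 + 1)) K) else X i + C (-1 * b i) * X c₀ with hush
  set P := aeval sh F with hPdef
  set σ : Fin (m + 2 + 1) → MvPolynomial (Fin (m + 2 + 1)) K := fun i => aeval τ' (ush i) with hσ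
  set σ' : Fin (m + 2 + 1) → MvPolynomial (Fin (m + 2 + 1)) K := fun i => aeval sh (τ i) with hσ'
  set e : Fin (m + 2 + 1) → K := Pi.single c 1 with he
  set e₀ : Fin (m + 2 + 1) → K := Pi.single c₀ 1 with he₀
  set lam : K := eval e (τ' c₀) with hlam
  have hush_sh : ∀ i, aeval ush (sh i) = X i := fun i => by
    have h := aeval_shear_shear c₀ b 1 i
    rwa [show (-(1 : K)) = -1 from rfl] at h
  have hsh_ush : ∀ i, aeval sh (ush i) = X i := fun i => by
    have h := aeval_shear_shear c₀ b (-1) i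
    rwa [neg_neg] at h
  have hshlin : ∀ i, (sh i).IsHomogeneous 1 := isHomogeneous_shear c₀ b 1
  have hushlin : ∀ i, (ush i).IsHomogeneous 1 := isHomogeneous_shear c₀ b (-1)
  have hP : P.IsHomogeneous d := by
    have h := hF.aeval sh hshlin
    rwa [one_mul] at h
  have hdehP : ProjectiveSpace.dehomogenize K c₀ P = Φ + (Ψ₁ + Ψ') := by
    rw [hPdef, dehomogenize_shear_eq_translate]; exact heq
  have hσsh : ∀ l, aeval σ (sh l) = τ' l := fun l => by
    rw [hσ, ← MvPolynomial.comp_aeval, AlgHom.comp_apply, hush_sh, aeval_X]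
  have hσ'τ' : ∀ l, aeval σ' (τ' l) = sh l := fun l => by
    rw [hσ', ← MvPolynomial.comp_aeval, AlgHom.comp_apply, hinv, aeval_X]
  have hG : aeval σ P = aeval τ' F := by
    rw [hPdef, ← AlgHom.comp_apply, MvPolynomial.comp_aeval, show (fun i => aeval σ (sh i)) = τ' from funext hσsh]
  have hinvσ : ∀ i, aeval σ (σ' i) = X i := fun i => by
    show aeval σ (aeval sh (τ i)) = X i
    rw [← AlgHom.comp_apply, MvPolynomial.comp_aeval, show (fun l => aeval σ (sh l)) = τ' from funext hσsh, hinv']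
  have hinvσ' : ∀ i, aeval σ' (σ i) = X i := fun i => by
    show aeval σ' (aeval τ' (ush i)) = X i
    rw [← AlgHom.comp_apply, MvPolynomial.comp_aeval, show (fun l => aeval σ' (τ' l)) = sh from funext hσ'τ', hsh_ush]
  have hσlin : ∀ i, (σ i).IsHomogeneous 1 := fun i => by
    have h := (hushlin i).aeval τ' hτ'
    rwa [one_mul] at h
  have hσ'lin : ∀ i, (σ' i).IsHomogeneous 1 := fun i => by
    have h := (hτ i).aeval sh hshlin
    rwa [one_mul] at h
  have hσc₀ : σ c₀ = τ' c₀ := by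
    show aeval τ' (ush c₀) = τ' c₀
    rw [show ush c₀ = X c₀ by simp [hush], aeval_X]
  -- `σ` maps `e_c` to the line of `e_{c₀}`
  have hσe : ∀ i, i ≠ c₀ → eval e (σ i) = 0 := fun i hi => by
    have h1 : σ i = τ' i + C (-1 * b i) * τ' c₀ := by
      simp only [hσ, hush, if_neg hi, map_add, map_mul, aeval_X, aeval_C, MvPolynomial.algebraMap_eq]
    rw [h1, map_add, map_mul, eval_C, hbτ i]
    ring
  have hσfix : ∀ i, i ≠ c₀ → constantCoeff (ProjectiveSpace.dehomogenize K c (σ i)) = 0 := fun i hi => by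
    rw [constantCoeff_dehomogenize]; exact hσe i hi
  have hlam0 : lam ≠ 0 := by
    intro h0
    have hall : ∀ j, eval e (τ' j) = 0 := fun j => by rw [hbτ j, h0, zero_mul]
    have h1 := eval_linSubst_point τ τ' hinv' e c
    rw [show (fun j => eval e (τ' j)) = (0 : Fin (m + 2 + 1) → K) from funext fun j => by rw [hall j]; rfl,
      eval_zero_of_isHomogeneous_one (hτ c), he, Pi.single_eq_same] at h1
    exact zero_ne_one h1
  -- `σ'` maps `e_{c₀}` to the line of `e_c`
  have hshe : (fun l => eval e₀ (sh l)) = b := by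
    funext l
    by_cases hl : l = c₀
    · subst hl
      simp only [hsh, if_pos rfl, eval_X, he₀, Pi.single_eq_same, hb1]
    · simp only [hsh, if_neg hl, map_add, map_mul, eval_X, eval_C, he₀, Pi.single_eq_same, Pi.single_eq_of_ne hl]
      ring
  have hbe : b = lam⁻¹ • fun j => eval e (τ' j) := by
    funext i
    rw [Pi.smul_apply, smul_eq_mul, hbτ i, ← mul_assoc, inv_mul_cancel₀ hlam0, one_mul]
  have hσ'e : ∀ i, i ≠ c → eval e₀ (σ' i) = 0 := fun i hi => by
    show eval e₀ (aeval sh (τ i)) = 0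
    rw [eval_aeval_eq_eval, hshe, hbe, eval_smul_of_isHomogeneous_one (hτ i), eval_linSubst_point τ τ' hinv' e i, he,
      Pi.single_eq_of_ne hi, mul_zero]
  -- linear parts
  set M : Fin (m + 2) → MvPolynomial (Fin (m + 2)) K := fun j => ProjectiveSpace.dehomogenize K c (σ (c₀.succAbove j)) with hM
  set M' : Fin (m + 2) → MvPolynomial (Fin (m + 2)) K := fun j => ProjectiveSpace.dehomogenize K c₀ (σ' (c.succAbove j)) with hM'
  have hM'lin : ∀ j, (M' j).IsHomogeneous 1 := fun j =>
    isHomogeneous_one_dehomogenize c₀ (hσ'lin _) (hσ'e _ (Fin.succAbove_ne c j))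
  have hMlin : ∀ j, (M j).IsHomogeneous 1 := fun j =>
    isHomogeneous_one_dehomogenize c (hσlin _) (hσe _ (Fin.succAbove_ne c₀ j))
  have hMM' : ∀ j, aeval M (M' j) = X j := fun j => aeval_linearPart_linearPart₂ c c₀ σ σ' hσ'lin hinvσ hσ'e j
  have hM'M : ∀ j, aeval M' (M j) = X j := fun j => aeval_linearPart_linearPart₂ c₀ c σ' σ hσlin hinvσ' hσe j
  have hM'0 : ∀ j, M' j ∈ Ideal.span (Set.range (X : Fin (m + 2) → MvPolynomial (Fin (m + 2)) K)) := fun j =>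
    OrdPoint.mem_span_X_of_isHomogeneous K (M' j) (hM'lin j) le_rfl
  -- `μ ≤ d`
  have hμd : μ ≤ d := by
    by_contra hlt
    push Not at hlt
    obtain ⟨hQμ, -⟩ := homogeneousComponent_add_of_mem_pow hΦ (add_mem_pow_succ K hΨ₁ hΨ')
    have h0 : homogeneousComponent μ (ProjectiveSpace.dehomogenize K c₀ P) = 0 :=
      homogeneousComponent_eq_zero μ _ (lt_of_le_of_lt (totalDegree_dehomogenize_le c₀ hP) hlt)
    rw [hdehP, hQμ] at h0
    exact hΦ0 h0
  -- the two-term expansion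
  obtain ⟨Ψ'', hΨ'', hexp⟩ := dehomogenize_aeval_eq_initial_two_add₂ c c₀ hP hΦ hΨ₁ hΨ' hμd hdehP σ hσfix
  have hlam' : constantCoeff (ProjectiveSpace.dehomogenize K c (σ c₀)) = lam := by
    rw [constantCoeff_dehomogenize, hlam, hσc₀]
  rw [hlam'] at hexp
  -- the linear part `L` of `ρ_{c₀}`
  set L : MvPolynomial (Fin (m + 2)) K := ProjectiveSpace.dehomogenize K c (σ c₀) - C lam with hL
  have hL1 : L.IsHomogeneous 1 := by
    have hq : (σ c₀ - C lam * X c).IsHomogeneous 1 := by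
      refine (hσlin c₀).sub ?_
      have h := (isHomogeneous_C (Fin (m + 2 + 1)) lam).mul (isHomogeneous_X K c)
      rwa [zero_add] at h
    have hq0 : eval e (σ c₀ - C lam * X c) = 0 := by
      rw [map_sub, map_mul, eval_C, eval_X, hσc₀, he, Pi.single_eq_same, mul_one, ← hlam, sub_self]
    have h := isHomogeneous_one_dehomogenize c hq hq0
    have hLq : ProjectiveSpace.dehomogenize K c (σ c₀ - C lam * X c) = L := by
      rw [map_sub, map_mul, MvPolynomial.algHom_C, MvPolynomial.algebraMap_eq, ProjectiveSpace.dehomogenize_X_self, mul_one, hL]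
    rwa [hLq] at h
  -- the new leading forms
  refine ⟨C (lam ^ (d - μ)) * aeval M Φ,
    C (((d - μ : ℕ) : K) * lam ^ (d - μ - 1)) * L * aeval M Φ + C (lam ^ (d - μ - 1)) * aeval M Ψ₁, Ψ'', ?_, ?_, ?_, hΨ'', ?_, ?_⟩
  · have h1 := hΦ.aeval M hMlin
    have h2 := (isHomogeneous_C (Fin (m + 2)) (lam ^ (d - μ))).mul h1
    simpa using h2
  · exact mul_ne_zero (by rw [Ne, MvPolynomial.C_eq_zero]; exact pow_ne_zero _ hlam0) (aeval_ne_zero_of_linSubst K M M' hM'M hΦ0)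
  · refine IsHomogeneous.add ?_ ?_
    · have h := ((isHomogeneous_C (Fin (m + 2)) (((d - μ : ℕ) : K) * lam ^ (d - μ - 1))).mul hL1).mul (hΦ.aeval M hMlin)
      rw [show μ + 1 = 0 + 1 + 1 * μ by ring]
      exact h
    · have h := (isHomogeneous_C (Fin (m + 2)) (lam ^ (d - μ - 1))).mul (hΨ₁.aeval M hMlin)
      rw [show μ + 1 = 0 + 1 * (μ + 1) by ring]
      exact h
  · rw [← hG, hexp]
  · exact firstOrder_of_linSubst K M M' hMM' hM'M hM'0 hfo (pow_ne_zero _ hlam0) (pow_ne_zero _ hlam0)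
      (C (((d - μ : ℕ) : K) * lam ^ (d - μ - 1)) * L)

end FirstOrderPoint

end Summit.ResolutionOfSingularities.ResolutionOfSingularities.Cruxes.EquisingularLiftNat.Sections

end
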